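/-
Copyright (c) 2026. Released under Apache 2.0 license.
-/
import Literature.NumberTheory.Automorphic.UnboundedDenominatorsInvariantHom
import HarnessLib

/-!
# Lower bounds for the level of `[SL₂(ℤ), Γ(N)]`, and the obstruction at `2` when `4 ∣ N`

By [Beyl1986] (Schur multiplier of `SL₂(ℤ/N)`: trivial if `4 ∤ N`, `ℤ/2` if `4 ∣ N`) the commutator subgroup
`K_N = [SL₂(ℤ), Γ(N)]` is a congruence subgroup of level `lcm(N, 12)` when `4 ∤ N` and `lcm(2N, 24)` when
`4 ∣ N`; the invariant form of [CalegariDimitrovTang2025, Cor. 4.5.3] is the statement that it is a congruence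
subgroup at all (`UnboundedDenominatorsInvariantHom`).  This file proves the LOWER-BOUND half of Beyl's
level statement, unconditionally:

* `lcm_dvd_of_Gamma_le_commutator` — if `Γ(M) ≤ [SL₂(ℤ), Γ(N)]` (`N, M ≥ 1`) then `lcm(N, 12) ∣ M`
  (`K_N ≤ Γ(N) ∩ [SL₂(ℤ), SL₂(ℤ)]` and the level of `[SL₂(ℤ), SL₂(ℤ)]` is `12`);
* `exists_invariant_hom_of_even` — for even `N` the map `1 + N X ↦ x₁₁ + x₁₂ + x₂₁ (mod 2)` is an
  `SL₂(ℤ)`-INVARIANT homomorphism `Γ(N) → ℤ/2`, trivial on `Γ(2N)`, with value `k (mod 2)` at `T^{Nk}`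
  (it is the `SL₂(𝔽₂)`-coinvariant quotient of `Γ(N)/Γ(2N) ≅ 𝔰𝔩₂(𝔽₂)`);
* `T_pow_lcm_notMem_commutator_of_four_dvd`, `not_Gamma_lcm_le_commutator_of_four_dvd`,
  `lcm_two_mul_dvd_of_Gamma_le_commutator_of_four_dvd` — hence for `4 ∣ N` the element `T^{lcm(N,12)}` is NOT
  in `K_N`, `Γ(lcm(N, 12)) ⊄ K_N`, and `Γ(M) ≤ K_N` forces `lcm(2N, 12) = lcm(2N, 24) ∣ M`: the naive level
  `lcm(N, 12)` (which is correct for `4 ∤ N`) fails exactly by the factor `2` coming from `M(SL₂(ℤ/N)) = ℤ/2`.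

Not here: the upper bounds (that `K_N ⊇ Γ(lcm(N,12))`, resp. `Γ(lcm(2N,24))`), i.e. the invariant form itself.
-/

open scoped MatrixGroups

namespace Literature.NumberTheory.Automorphic

namespace UnboundedDenominators

open CongruenceSubgroup Matrix Matrix.SpecialLinearGroup ModularGroup

/-! ### Divisibility constraints from `K_N ≤ Γ(N) ∩ [SL₂(ℤ), SL₂(ℤ)]` -/

/-- `[SL₂(ℤ), Γ(N)] ≤ Γ(N)`. [cite: CalegariDimitrovTang2025, Corollary 4.5.3] -/
theorem commutator_top_Gamma_le (N : ℕ) : ⁅(⊤ : Subgroup SL(2, ℤ)), Gamma N⁆ ≤ Gamma N := by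
  haveI := Gamma_normal N
  exact Subgroup.commutator_le_right _ _

/-- `[SL₂(ℤ), Γ(N)] ≤ [SL₂(ℤ), SL₂(ℤ)]`. [cite: CalegariDimitrovTang2025, Corollary 4.5.3] -/
theorem commutator_top_Gamma_le_commutator (N : ℕ) :
    ⁅(⊤ : Subgroup SL(2, ℤ)), Gamma N⁆ ≤ commutator SL(2, ℤ) := by
  rw [commutator_def]
  exact Subgroup.commutator_mono le_rfl le_top

/-- `T^{M} ∈ Γ(N)` iff `N ∣ M` (integers `M`). [folklore] -/
private theorem T_zpow_mem_Gamma_iff (N : ℕ) (M : ℤ) : T ^ M ∈ Gamma N ↔ (N : ℤ) ∣ M := by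
  rw [Gamma_mem]
  simp only [coe_T_zpow, of_apply, cons_val', cons_val_zero, cons_val_one, cons_val_fin_one,
    Int.cast_one, Int.cast_zero, true_and, and_true]
  exact ZMod.intCast_zmod_eq_zero_iff_dvd M N

/-- If `Γ(M) ≤ Γ(N)` and `M ≠ 0` then `N ∣ M` (test on `T^M`). [folklore] -/
private theorem dvd_of_Gamma_le_Gamma {N M : ℕ} (h : Gamma M ≤ Gamma N) : N ∣ M := by
  have hT : T ^ (M : ℤ) ∈ Gamma M := (T_zpow_mem_Gamma_iff M M).mpr (dvd_refl _)
  exact_mod_cast (T_zpow_mem_Gamma_iff N M).mp (h hT)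

/-- **Lower bound for the level of `K_N = [SL₂(ℤ), Γ(N)]`**: if `Γ(M) ≤ K_N` with `N, M ≥ 1` then
`lcm(N, 12) ∣ M` (`K_N ≤ Γ(N)` gives `N ∣ M`; `K_N ≤ [SL₂(ℤ), SL₂(ℤ)]`, whose level is `12`, gives `12 ∣ M`).
For `4 ∤ N` this is the exact level [Beyl1986]. [cite: Beyl1986, Theorem] -/
theorem lcm_dvd_of_Gamma_le_commutator {N M : ℕ} (hM : M ≠ 0)
    (h : Gamma M ≤ ⁅(⊤ : Subgroup SL(2, ℤ)), Gamma N⁆) : Nat.lcm N 12 ∣ M := by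
  refine Nat.lcm_dvd (dvd_of_Gamma_le_Gamma (h.trans (commutator_top_Gamma_le N))) ?_
  exact (Literature.NumberTheory.ModularForms.SL2Z.Gamma_le_commutator_iff hM).mp
    (h.trans (commutator_top_Gamma_le_commutator N))

/-! ### The invariant character `Γ(N) → ℤ/2` for even `N` -/

/-- The identity over `𝔽₂` behind the `SL₂(ℤ)`-invariance of `1 + NX ↦ x₁₁ + x₁₂ + x₂₁`: the linear form
`ℓ(X) = x₁₁ + x₁₂ + x₂₁` on trace-zero `2 × 2` matrices over `𝔽₂` is invariant under conjugation by `SL₂(𝔽₂)`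
(checked on all `2⁸` tuples). [folklore] -/
private theorem ell_conj_eq : ∀ p q r s α β κ δ : ZMod 2, p * s - q * r = 1 → α + δ = 0 →
    ((p * α + q * κ) * s - (p * β + q * δ) * r) + (-((p * α + q * κ) * q) + (p * β + q * δ) * p) +
      ((r * α + s * κ) * s - (r * β + s * δ) * r) = α + β + κ := by
  decide

/-- Entries of an element of `Γ(N)`: `γ = 1 + N X` with `X` integral. [folklore] -/
private theorem exists_entries_eq {N : ℕ} {γ : SL(2, ℤ)} (hγ : γ ∈ Gamma N) :
    ∃ α β κ δ : ℤ, (γ 0 0 : ℤ) = 1 + N * α ∧ (γ 0 1 : ℤ) = N * β ∧ (γ 1 0 : ℤ) = N * κ ∧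
      (γ 1 1 : ℤ) = 1 + N * δ := by
  obtain ⟨h00, h01, h10, h11⟩ := Gamma_mem.mp hγ
  obtain ⟨α, hα⟩ := (ZMod.intCast_eq_intCast_iff_dvd_sub 1 (γ 0 0) N).mp (by simpa using h00.symm)
  obtain ⟨β, hβ⟩ := (ZMod.intCast_zmod_eq_zero_iff_dvd _ N).mp h01
  obtain ⟨κ, hκ⟩ := (ZMod.intCast_zmod_eq_zero_iff_dvd _ N).mp h10
  obtain ⟨δ, hδ⟩ := (ZMod.intCast_eq_intCast_iff_dvd_sub 1 (γ 1 1) N).mp (by simpa using h11.symm)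
  exact ⟨α, β, κ, δ, by linear_combination hα, hβ, hκ, by linear_combination hδ⟩

/-- **The invariant character at `2`.** For even `N ≥ 2` there is a homomorphism `θ : Γ(N) → ℤ/2`,
`θ(1 + NX) = x₁₁ + x₁₂ + x₂₁ (mod 2)`, which is invariant under conjugation by all of `SL₂(ℤ)`, trivial on
`Γ(2N)`, and takes the value `k (mod 2)` on `T^{Nk}`.  (It is the projection of `Γ(N)/Γ(2N) ≅ 𝔰𝔩₂(𝔽₂)` onto
its `SL₂(𝔽₂)`-coinvariants `𝔰𝔩₂(𝔽₂)/⟨1 + E, E + F⟩ ≅ 𝔽₂`; for `4 ∣ N` it is the class detecting Beyl's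
`M(SL₂(ℤ/N)) = ℤ/2`.) [cite: Beyl1986, Theorem] -/
theorem exists_invariant_hom_of_even {N : ℕ} (hN : N ≠ 0) (h2 : 2 ∣ N) :
    ∃ θ : Gamma N →* Multiplicative (ZMod 2),
      (∀ (g x : SL(2, ℤ)) (hx : x ∈ Gamma N) (hgx : g * x * g⁻¹ ∈ Gamma N),
        θ ⟨g * x * g⁻¹, hgx⟩ = θ ⟨x, hx⟩) ∧
      (∀ (x : SL(2, ℤ)) (hx : x ∈ Gamma N), x ∈ Gamma (2 * N) → θ ⟨x, hx⟩ = 1) ∧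
      (∀ (k : ℤ) (hk : T ^ ((N : ℤ) * k) ∈ Gamma N),
        θ ⟨T ^ ((N : ℤ) * k), hk⟩ = Multiplicative.ofAdd (k : ZMod 2)) := by
  have hN' : (N : ℤ) ≠ 0 := by exact_mod_cast hN
  have hN2 : (N : ZMod 2) = 0 := (ZMod.natCast_eq_zero_iff_even).mpr (even_iff_two_dvd.mpr h2)
  -- the function on `Γ(N)`
  let F : Gamma N → ZMod 2 := fun γ ↦
    ((((γ : SL(2, ℤ)) 0 0 - 1) / N + ((γ : SL(2, ℤ)) 0 1) / N + ((γ : SL(2, ℤ)) 1 0) / N : ℤ) : ZMod 2)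
  have hF : ∀ (γ : Gamma N) (α β κ : ℤ), ((γ : SL(2, ℤ)) 0 0 : ℤ) = 1 + N * α →
      ((γ : SL(2, ℤ)) 0 1 : ℤ) = N * β → ((γ : SL(2, ℤ)) 1 0 : ℤ) = N * κ →
      F γ = ((α + β + κ : ℤ) : ZMod 2) := by
    intro γ α β κ ha hb hc
    simp only [F]
    rw [ha, hb, hc, add_sub_cancel_left, Int.mul_ediv_cancel_left _ hN', Int.mul_ediv_cancel_left _ hN',
      Int.mul_ediv_cancel_left _ hN']
  -- trace condition: `α + δ` is even
  have htr : ∀ (γ : SL(2, ℤ)) (α β κ δ : ℤ), (γ 0 0 : ℤ) = 1 + N * α → (γ 0 1 : ℤ) = N * β →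
      (γ 1 0 : ℤ) = N * κ → (γ 1 1 : ℤ) = 1 + N * δ → ((α + δ : ℤ) : ZMod 2) = 0 := by
    intro γ α β κ δ ha hb hc hd
    have hdet := det_coe γ
    rw [Matrix.det_fin_two, ha, hb, hc, hd] at hdet
    have h1 : (N : ℤ) * (α + δ + N * (α * δ - β * κ)) = 0 := by linear_combination hdet
    have h2 : α + δ = -(N * (α * δ - β * κ)) := by
      have := (mul_eq_zero.mp h1).resolve_left hN'
      linear_combination this
    rw [h2]; push_cast; rw [hN2]; ring
  -- multiplicativity
  have hmul : ∀ γ γ' : Gamma N, F (γ * γ') = F γ + F γ' := by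
    intro γ γ'
    obtain ⟨α, β, κ, δ, ha, hb, hc, hd⟩ := exists_entries_eq γ.2
    obtain ⟨α', β', κ', δ', ha', hb', hc', hd'⟩ := exists_entries_eq γ'.2
    have e00 : (((γ * γ' : Gamma N) : SL(2, ℤ)) 0 0 : ℤ) = 1 + N * (α + α' + N * (α * α' + β * κ')) := by
      have : (((γ * γ' : Gamma N) : SL(2, ℤ)) 0 0 : ℤ) = (γ : SL(2, ℤ)) 0 0 * (γ' : SL(2, ℤ)) 0 0 +
          (γ : SL(2, ℤ)) 0 1 * (γ' : SL(2, ℤ)) 1 0 := by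
        simp [Matrix.mul_apply, Fin.sum_univ_two]
      rw [this, ha, hb, ha', hc']; ring
    have e01 : (((γ * γ' : Gamma N) : SL(2, ℤ)) 0 1 : ℤ) = N * (β + β' + N * (α * β' + β * δ')) := by
      have : (((γ * γ' : Gamma N) : SL(2, ℤ)) 0 1 : ℤ) = (γ : SL(2, ℤ)) 0 0 * (γ' : SL(2, ℤ)) 0 1 +
          (γ : SL(2, ℤ)) 0 1 * (γ' : SL(2, ℤ)) 1 1 := by
        simp [Matrix.mul_apply, Fin.sum_univ_two]
      rw [this, ha, hb, hb', hd']; ring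
    have e10 : (((γ * γ' : Gamma N) : SL(2, ℤ)) 1 0 : ℤ) = N * (κ + κ' + N * (κ * α' + δ * κ')) := by
      have : (((γ * γ' : Gamma N) : SL(2, ℤ)) 1 0 : ℤ) = (γ : SL(2, ℤ)) 1 0 * (γ' : SL(2, ℤ)) 0 0 +
          (γ : SL(2, ℤ)) 1 1 * (γ' : SL(2, ℤ)) 1 0 := by
        simp [Matrix.mul_apply, Fin.sum_univ_two]
      rw [this, hc, hd, ha', hc']; ring
    rw [hF _ _ _ _ e00 e01 e10, hF γ α β κ ha hb hc, hF γ' α' β' κ' ha' hb' hc']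
    push_cast
    rw [hN2]
    ring
  have hone : F 1 = 0 := by
    rw [hF 1 0 0 0 (by simp) (by simp) (by simp)]
    push_cast; ring
  let θ : Gamma N →* Multiplicative (ZMod 2) :=
    { toFun := fun γ ↦ Multiplicative.ofAdd (F γ)
      map_one' := by rw [hone, ofAdd_zero]
      map_mul' := fun a b ↦ by rw [hmul, ofAdd_add] }
  have hθ : ∀ γ : Gamma N, θ γ = Multiplicative.ofAdd (F γ) := fun γ ↦ rfl
  refine ⟨θ, ?_, ?_, ?_⟩
  · -- invariance
    intro g x hx hgx
    rw [hθ, hθ]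
    congr 1
    obtain ⟨α, β, κ, δ, ha, hb, hc, hd⟩ := exists_entries_eq hx
    have hdet : (g 0 0 : ℤ) * g 1 1 - g 0 1 * g 1 0 = 1 := by
      have h := det_coe g; rwa [Matrix.det_fin_two] at h
    -- entries of `g x g⁻¹ = 1 + N · gXg⁻¹`
    have i00 : ((g * x * g⁻¹) 0 0 : ℤ) = (g 0 0 * x 0 0 + g 0 1 * x 1 0) * g 1 1 +
        (g 0 0 * x 0 1 + g 0 1 * x 1 1) * (-(g 1 0)) := by
      simp [coe_inv, Matrix.adjugate_fin_two, Matrix.mul_apply, Fin.sum_univ_two]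
    have i01 : ((g * x * g⁻¹) 0 1 : ℤ) = (g 0 0 * x 0 0 + g 0 1 * x 1 0) * (-(g 0 1)) +
        (g 0 0 * x 0 1 + g 0 1 * x 1 1) * g 0 0 := by
      simp [coe_inv, Matrix.adjugate_fin_two, Matrix.mul_apply, Fin.sum_univ_two]
    have i10 : ((g * x * g⁻¹) 1 0 : ℤ) = (g 1 0 * x 0 0 + g 1 1 * x 1 0) * g 1 1 +
        (g 1 0 * x 0 1 + g 1 1 * x 1 1) * (-(g 1 0)) := by
      simp [coe_inv, Matrix.adjugate_fin_two, Matrix.mul_apply, Fin.sum_univ_two]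
    set p : ℤ := g 0 0
    set q : ℤ := g 0 1
    set r : ℤ := g 1 0
    set s : ℤ := g 1 1
    have e00 : ((g * x * g⁻¹) 0 0 : ℤ) = 1 + N * ((p * α + q * κ) * s - (p * β + q * δ) * r) := by
      rw [i00, ha, hb, hc, hd]; linear_combination hdet
    have e01 : ((g * x * g⁻¹) 0 1 : ℤ) = N * (-((p * α + q * κ) * q) + (p * β + q * δ) * p) := by
      rw [i01, ha, hb, hc, hd]; linear_combination (0 : ℤ) * hdet
    have e10 : ((g * x * g⁻¹) 1 0 : ℤ) = N * ((r * α + s * κ) * s - (r * β + s * δ) * r) := by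
      rw [i10, ha, hb, hc, hd]; linear_combination (0 : ℤ) * hdet
    rw [hF ⟨g * x * g⁻¹, hgx⟩ _ _ _ e00 e01 e10, hF ⟨x, hx⟩ α β κ ha hb hc]
    have hdet2 : ((p : ZMod 2)) * (s : ZMod 2) - (q : ZMod 2) * (r : ZMod 2) = 1 := by
      have := congrArg (Int.cast : ℤ → ZMod 2) hdet
      push_cast at this
      exact this
    have htr2 : ((α : ZMod 2)) + (δ : ZMod 2) = 0 := by
      have := htr x α β κ δ ha hb hc hd
      push_cast at this
      exact this
    push_cast
    exact ell_conj_eq _ _ _ _ _ _ _ _ hdet2 htr2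
  · -- trivial on `Γ(2N)`
    intro x hx hx2
    rw [hθ, ← ofAdd_zero]
    congr 1
    obtain ⟨α, β, κ, δ, ha, hb, hc, -⟩ := exists_entries_eq hx2
    push_cast at ha hb hc
    rw [hF ⟨x, hx⟩ (2 * α) (2 * β) (2 * κ) (by rw [ha]; ring) (by rw [hb]; ring) (by rw [hc]; ring)]
    push_cast
    rw [show (2 : ZMod 2) = 0 from rfl]
    ring
  · -- value on `T^{Nk}`
    intro k hk
    rw [hθ]
    congr 1
    rw [hF ⟨T ^ ((N : ℤ) * k), hk⟩ 0 k 0 (by simp [coe_T_zpow]) (by simp [coe_T_zpow])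
      (by simp [coe_T_zpow])]
    push_cast
    ring

/-! ### Consequences for `4 ∣ N` -/

/-- For `4 ∣ N`: `lcm(N, 12) = N · k` with `k` ODD (`k ∣ 3`). [folklore] -/
private theorem lcm_eq_mul_odd {N : ℕ} (hN : N ≠ 0) (h4 : 4 ∣ N) :
    ∃ k : ℕ, Nat.lcm N 12 = N * k ∧ Odd k := by
  obtain ⟨k, hk⟩ := Nat.dvd_lcm_left N 12
  refine ⟨k, hk, ?_⟩
  have h3 : Nat.lcm N 12 ∣ N * 3 := by
    refine Nat.lcm_dvd (dvd_mul_right N 3) ?_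
    obtain ⟨m, rfl⟩ := h4
    exact ⟨m, by ring⟩
  rw [hk] at h3
  have hk3 : k ∣ 3 := Nat.dvd_of_mul_dvd_mul_left (Nat.pos_of_ne_zero hN) h3
  exact Odd.of_dvd_nat (by decide) hk3

/-- **`T^{lcm(N,12)} ∉ [SL₂(ℤ), Γ(N)]` when `4 ∣ N`**: the invariant character at `2` is trivial on the
commutator (`map_eq_one_of_mem_commutator`) but takes the value `lcm(N,12)/N ≡ 1 (mod 2)` at
`T^{lcm(N,12)}`.  So for `4 ∣ N` the commutator `[SL₂(ℤ), Γ(N)]` is strictly smaller than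
`Γ(N) ∩ [SL₂(ℤ), SL₂(ℤ)]`. [cite: Beyl1986, Theorem] -/
theorem T_pow_lcm_notMem_commutator_of_four_dvd {N : ℕ} (hN : N ≠ 0) (h4 : 4 ∣ N) :
    (T : SL(2, ℤ)) ^ Nat.lcm N 12 ∉ ⁅(⊤ : Subgroup SL(2, ℤ)), Gamma N⁆ := by
  obtain ⟨k, hk, hodd⟩ := lcm_eq_mul_odd hN h4
  obtain ⟨θ, hinv, -, hT⟩ := exists_invariant_hom_of_even hN (dvd_trans ⟨2, rfl⟩ h4)
  intro hmem
  have hmemZ : (T : SL(2, ℤ)) ^ ((N : ℤ) * k) ∈ ⁅(⊤ : Subgroup SL(2, ℤ)), Gamma N⁆ := by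
    rw [← Nat.cast_mul, zpow_natCast, ← hk]; exact hmem
  have hΓ : (T : SL(2, ℤ)) ^ ((N : ℤ) * k) ∈ Gamma N := commutator_top_Gamma_le N hmemZ
  have h1 := map_eq_one_of_mem_commutator θ hinv hmemZ hΓ
  rw [hT k hΓ, ofAdd_eq_one, Int.cast_natCast, ZMod.natCast_eq_zero_iff_even] at h1
  exact (Nat.not_even_iff_odd.mpr hodd) h1

/-- **`Γ(lcm(N, 12)) ⊄ [SL₂(ℤ), Γ(N)]` when `4 ∣ N`** (whereas for `4 ∤ N` the level IS `lcm(N, 12)`,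
[Beyl1986]). [cite: Beyl1986, Theorem] -/
theorem not_Gamma_lcm_le_commutator_of_four_dvd {N : ℕ} (hN : N ≠ 0) (h4 : 4 ∣ N) :
    ¬ Gamma (Nat.lcm N 12) ≤ ⁅(⊤ : Subgroup SL(2, ℤ)), Gamma N⁆ := by
  intro h
  refine T_pow_lcm_notMem_commutator_of_four_dvd hN h4 (h ?_)
  have := (T_zpow_mem_Gamma_iff (Nat.lcm N 12) (Nat.lcm N 12 : ℕ)).mpr (dvd_refl _)
  rwa [zpow_natCast] at this

/-- **The `2`-adic lower bound for `4 ∣ N`**: if `Γ(M) ≤ [SL₂(ℤ), Γ(N)]` then `2N ∣ M` (test the invariant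
character at `2` on `T^M`). [cite: Beyl1986, Theorem] -/
theorem two_mul_dvd_of_Gamma_le_commutator_of_four_dvd {N M : ℕ} (hN : N ≠ 0) (h4 : 4 ∣ N)
    (h : Gamma M ≤ ⁅(⊤ : Subgroup SL(2, ℤ)), Gamma N⁆) : 2 * N ∣ M := by
  obtain ⟨k, rfl⟩ := dvd_of_Gamma_le_Gamma (h.trans (commutator_top_Gamma_le N))
  obtain ⟨θ, hinv, -, hT⟩ := exists_invariant_hom_of_even hN (dvd_trans ⟨2, rfl⟩ h4)
  have hmem : (T : SL(2, ℤ)) ^ ((N : ℤ) * k) ∈ Gamma (N * k) := by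
    rw [← Nat.cast_mul]; exact (T_zpow_mem_Gamma_iff (N * k) _).mpr (dvd_refl _)
  have hΓ : (T : SL(2, ℤ)) ^ ((N : ℤ) * k) ∈ Gamma N := commutator_top_Gamma_le N (h hmem)
  have h1 := map_eq_one_of_mem_commutator θ hinv (h hmem) hΓ
  rw [hT k hΓ, ofAdd_eq_one, Int.cast_natCast, ZMod.natCast_eq_zero_iff_even] at h1
  obtain ⟨m, rfl⟩ := h1
  exact ⟨m, by ring⟩

/-- **Lower bound for the level of `[SL₂(ℤ), Γ(N)]` when `4 ∣ N`**: `Γ(M) ≤ [SL₂(ℤ), Γ(N)]` (`M ≥ 1`) forces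
`lcm(2N, 12) ∣ M` (`= lcm(2N, 24)`, Beyl's exact level). [cite: Beyl1986, Theorem] -/
theorem lcm_two_mul_dvd_of_Gamma_le_commutator_of_four_dvd {N M : ℕ} (hN : N ≠ 0) (h4 : 4 ∣ N)
    (hM : M ≠ 0) (h : Gamma M ≤ ⁅(⊤ : Subgroup SL(2, ℤ)), Gamma N⁆) : Nat.lcm (2 * N) 12 ∣ M :=
  Nat.lcm_dvd (two_mul_dvd_of_Gamma_le_commutator_of_four_dvd hN h4 h)
    ((Nat.dvd_lcm_right N 12).trans (lcm_dvd_of_Gamma_le_commutator hM h))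

end UnboundedDenominators

end Literature.NumberTheory.Automorphic
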